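import Summits.KontsevichZagierPeriods.KontsevichZagierPeriods.Theorems.HurwitzMicroSectorsHurwitzSectorComplementStubOkadaMain
import Summits.KontsevichZagierPeriods.KontsevichZagierPeriods.Theorems.HurwitzMicroSectorsHurwitzSectorComplementStubPairValueAlgebraic

/-!
# Crux `HurwitzSectorComplement` (stmt-KontsevichZagierPeriods-14341), line `galois-parity-half`:
# stub `stub_okada` — Okada's theorem (1981), Hurwitz form, PROVED

For `w ≥ 2` and `L ≥ 3` the real numbers
`K(w,L,a) = Σ_{k≥0} (Lk+a)^{-w} + (−1)^w Σ_{k≥0} (Lk+L−a)^{-w} = L^{-w}(ζ(w,a/L) + (−1)^w ζ(w,1−a/L))`,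
`0 < a < L/2`, `gcd(a,L) = 1`, are `ℚ`-linearly independent. Equivalently (classical identity
`ζ(w,x) + (−1)^w ζ(w,1−x) = ((−1)^{w−1}/(w−1)!)·(d/dx)^{w−1}(π cot πx)`) the values of the `(w−1)`-st
derivative of `cot πz` at `z = a/L`, `a` in a half-system of reduced residues, are linearly independent
over `ℚ` — T. Okada, *On an extension of a theorem of S. Chowla*, Acta Arith. 38 (1981) 341–345,
Theorem; S. Gun, M. R. Murty, P. Rath, *On a conjecture of Chowla and Milnor*, Canad. J. Math. 63
(2011), Thm 1. Proof here: the Bernoulli–Fourier evaluation of the kernel sums (landed stub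
`stub_pairValueAlgebraic`'s `symHurwitz_eq_trig_sum`, `trigSum_cos_rat`, `trigSum_sin_rat`: rational
weights `B_w(j/L)` up to the factor `(2/L)·c_w·π^w`) fed into `Okada.okada_of_trig` (cyclotomic Galois
twisting + Dirichlet characters + `L(χ,w) ≠ 0` + orthogonality). No unproved input.
-/

noncomputable section

open scoped BigOperators Nat

namespace Summit.KontsevichZagierPeriods.Theorems.HurwitzMicroSectorsHurwitzSectorComplement

/-- **Okada's theorem, Hurwitz form** (registered stub `stub_okada` of the line `galois-parity-half`):
for `w ≥ 2`, `L ≥ 3` the symmetric kernel sums `K(w,L,a)`, `0 < a < L/2`, `gcd(a,L)=1`, are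
`ℚ`-linearly independent. [cite: Okada1981, Theorem] [cite: GunMurtyRath2011, Thm 1] -/
theorem stub_okada : ∀ (w L : ℕ), 2 ≤ w → 3 ≤ L → LinearIndependent ℚ (fun a : {a : ℕ // a ∈ (Finset.range L).filter (fun a => 2 * a < L ∧ Nat.Coprime a L)} => (∑' k : ℕ, 1 / ((L : ℝ) * k + a.1) ^ w) + (-1 : ℝ) ^ w * (∑' k : ℕ, 1 / ((L : ℝ) * k + ((L : ℝ) - a.1)) ^ w)) := by
  intro w L hw hL
  have hL0 : L ≠ 0 := by omega
  have hLpos : (0 : ℝ) < L := by exact_mod_cast Nat.pos_of_ne_zero hL0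
  rcases Nat.even_or_odd w with ⟨k, hk⟩ | ⟨k, hk⟩
  · -- even weight `w = 2k`, cosine sums
    obtain rfl : w = 2 * k := by omega
    have hk0 : k ≠ 0 := by omega
    refine Okada.okada_of_trig (2 * k) L hw hL
      (fun j => (-1) ^ (k + 1) * 2 ^ (2 * k) / 2 / (2 * k)! * (Polynomial.bernoulli (2 * k)).eval ((j : ℚ) / L))
      (2 / L * Real.pi ^ (2 * k)) (by positivity) (fun a ha haL => ?_)
    rw [PairValueAlgebraic.symHurwitz_eq_trig_sum (2 * k) L a hw ha haL, if_pos (even_two_mul k)]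
    simp only [even_two_mul, if_true]
    rw [mul_assoc, Finset.mul_sum, Finset.mul_sum, Finset.mul_sum]
    refine Finset.sum_congr rfl fun j hj => ?_
    have hjL : j ≤ L := (Finset.mem_range.mp hj).le
    rw [PairValueAlgebraic.trigSum_cos_rat hk0 hL0 hjL]
    have hang : Real.cos (2 * Real.pi * j * a / L) = Real.cos (2 * Real.pi * ((j * a : ℕ) : ℝ) / L) := by
      congr 1; push_cast; ring
    rw [hang]
    ring
  · -- odd weight `w = 2k+1`, sine sums
    subst hk
    have hk0 : k ≠ 0 := by omega
    refine Okada.okada_of_trig (2 * k + 1) L hw hL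
      (fun j => (-1) ^ (k + 1) * 2 ^ (2 * k + 1) / 2 / (2 * k + 1)! *
        (Polynomial.bernoulli (2 * k + 1)).eval ((j : ℚ) / L))
      (2 / L * Real.pi ^ (2 * k + 1)) (by positivity) (fun a ha haL => ?_)
    have hne : ¬ Even (2 * k + 1) := Nat.not_even_iff_odd.mpr (odd_two_mul_add_one k)
    rw [PairValueAlgebraic.symHurwitz_eq_trig_sum (2 * k + 1) L a hw ha haL, if_neg hne]
    simp only [hne, if_false]
    rw [mul_assoc, Finset.mul_sum, Finset.mul_sum, Finset.mul_sum]
    refine Finset.sum_congr rfl fun j hj => ?_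
    have hjL : j ≤ L := (Finset.mem_range.mp hj).le
    rw [PairValueAlgebraic.trigSum_sin_rat hk0 hL0 hjL]
    have hang : Real.sin (2 * Real.pi * j * a / L) = Real.sin (2 * Real.pi * ((j * a : ℕ) : ℝ) / L) := by
      congr 1; push_cast; ring
    rw [hang]
    ring

end Summit.KontsevichZagierPeriods.Theorems.HurwitzMicroSectorsHurwitzSectorComplement

end
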